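import Summits.HodgeConjecture.HodgeConjecture.Theorems.Ring2TransportWeilDivisorialAnchors
import Summits.HodgeConjecture.CorCM.AndreWeakFormOfRiemann
import HarnessLib

/-!
# Ring 2 · transport — the Weil rungs ⟷ `HC_CM` with ONE recorded input (Riemann's theorem) for the whole axis

HONEST FRAMING (page 1, verbatim as the cell requires):
research route conditional on HC_CM; not a corollary; Q11.4-sentence-2 already refuted in dim ≥ 3.

Cell `pub-hodge-ring2`, seat `transport` (HOME `run/shared/lean/pub/pub-hodge-ring2/`, map `RING2-MAP.md §transport`,
gen 53). `HC_CM` := the tree item `Summit.HodgeConjecture.HodgeConjecture.Theses.RankFourFaces.CMAbelianHodge`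
(stmt-HodgeConjecture-3052; `= Summit.HodgeConjecture.CorCM.HC_CM` by `rfl`, `CorCM/Interfaces.lean`), an explicit
HYPOTHESIS, one side of an `↔`, or the CONCLUSION of an implication from open inputs in every theorem below —
never a cited fact, never "known".

## What this file adds (0 `def`, 0 new fact, 0 `sorry`; every theorem an implication between NAMED statements)

Until now the axis displayed `HC_CM ↔ R∞ ∧ R3` (`HC_CM_iff_weilRungs_of_andre_of_transport`) and
`HC_CM`-as-CONCLUSION (`HC_CM_of_andre_of_weilDivisorialCMPointed_of_variational` and its divisor-generated /
diagonal corollaries) over FIVE inputs each: André's 1992 record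
`Andre1992_hodgeClasses_cmAbelianVariety_mem_span_pullback_weilClasses` and four transport leaves, two of them
QUADRATIC (`K = ℚ(√-d)`). Since 2026-08-20 cell `pub-hodgecm2` proves André's record as a KERNEL THEOREM modulo
the single Literature record `HodgeTheory.DeligneMilne1982_Thm_6_20_full` (Riemann's theorem = fullness of `H¹_B`,
Deligne–Milne 1982 Thm. 6.20, full form) — `CorCM.AndreWeakForm.andre1992_weak_of_riemann` — and, sharper,
`CorCM.AndreWeakForm.hc_cm_of_riemann_of_weilClassesCMField : hR → R3 → HC_CM` (the CM-FIELD member of André's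
target family ALONE suffices). The same record `hR` already keys this axis' residual
(`hodgeGroupH1CommutantSpan_of_riemann`, `cmTypeIffMumfordTateCommutative_of_riemann`). Consequences:

* §1 `HC_CM_iff_weilClassesCMField_of_riemann_of_transport[_local]` — granted `hR` and the two CM-FIELD leaves
  (`hP₃ : CMPointedWeilFamiliesCMField` and `hV₃ : WeilVariationalHodgeCMField`, resp. the local germ
  `hL : LocalWeilVHCAtCMField`) ONLY: `HC_CM ↔ R3`. The rung R∞ and both quadratic leaves LEAVE the equivalence.
* §2 `weilClassesImaginaryQuadratic_of_riemann_of_weilClassesCMField[_local]` — granted `hR` and the QUADRATIC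
  leaves, the single rung R3 (CM fields of degree `> 2`, OPEN in every dimension) implies Weil's 1977 question R∞
  (every imaginary quadratic `K`, every `n ≥ 2`, every `d`), hence everything below R∞ on the tree's ladder
  (`Theorems/WeilTypeLadderOnPath`). Not a specialisation (`2 < e` in `WeilTypeLadder.WeilClassesCMField`): the
  arrow goes THROUGH `HC_CM`.
* §3 `HC_CM_of_riemann_of_weilDivisorialCMPointed_of_variational[_local]` — `HC_CM` as the CONCLUSION from THREE
  inputs {Riemann's record, the Weil-divisorial CM-pointed `K`-Weil-family leaf, ONE CM-field transport leaf}
  instead of five; divisor-generated / diagonal anchors by the named arrows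
  `weilDivisorialCMPointed_of_divisorGeneratedCMPointed`, `weilDivisorialCMPointed_of_diagonalCMPointed`.
* §4 the two-rung equivalence re-keyed on `hR`, and the redundancy of its R∞-conjunct.

## Honest accounting

CITE-for-CITE: one Literature record (André 1992, a published theorem) is replaced by another (Deligne–Milne 1982
Thm. 6.20, a published theorem) that the axis residual already carries — ONE recorded input for the whole transport
axis. Nothing is discharged: `hR` is a `def … : Prop` record used as a hypothesis; every transport / anchor leaf is a
Summit-side `@[conjecture]` definition, OPEN as typed (variational Hodge on Weil families is the whole difficulty);
both sides of every `↔` are open statements; §3 is a kernel-checked IMPLICATION from open inputs, not a proof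
sketch of `HC_CM`; NO case of the Hodge conjecture is proved here. Junction by name only: this file imports
`CorCM/AndreWeakFormOfRiemann.lean` for two theorems and restates nothing of it. Preprints cited for shape are
UNREFEREED and inputs of no theorem.
-/

set_option linter.dupNamespace false

noncomputable section

namespace Summit.HodgeConjecture.HodgeConjecture.Ring2Transport

open Literature.AlgebraicGeometry.HodgeTheory
open Summit.HodgeConjecture.HodgeConjecture.WeilTypeLadder
open Summit.HodgeConjecture.HodgeConjecture.Theses

/-! ### §1 `HC_CM ↔ R3` modulo Riemann's theorem and the CM-field transport leaves -/

/-- **Granted Riemann's theorem (record `DeligneMilne1982_Thm_6_20_full`) and the two CM-field transport leaves,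
`HC_CM` is EQUIVALENT to the single rung R3 (`WeilTypeLadder.WeilClassesCMField`: Weil classes for CM fields of
degree `> 2`).** `→` is the transport theorem `HC_WeilClassesCMField_of_HC_CM` (uses `hP₃`, `hV₃`, not `hR`);
`←` is `CorCM.AndreWeakForm.hc_cm_of_riemann_of_weilClassesCMField` (uses `hR` only: André's reduction, CM-field
member alone, a kernel theorem of cell `pub-hodgecm2` modulo Riemann). CONDITIONAL on all three named inputs.
[cite: Andre1992HodgeCM, p. 2 and Théorème] [cite: DeligneMilne1982Tannakian, §6 Thm. 6.20 (Riemann), p. 212]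
[cite: Markman2025SurveySecant, Thm. 1.4 and §12 (preprint / ICM 2026 lecture, unrefereed)] -/
theorem HC_CM_iff_weilClassesCMField_of_riemann_of_transport (hR : DeligneMilne1982_Thm_6_20_full)
    (hP₃ : CMPointedWeilFamiliesCMField) (hV₃ : WeilVariationalHodgeCMField) :
    Theses.RankFourFaces.CMAbelianHodge ↔ WeilClassesCMField :=
  ⟨fun hCM ↦ HC_WeilClassesCMField_of_HC_CM hCM hP₃ hV₃,
    fun h₃ ↦ CorCM.AndreWeakForm.hc_cm_of_riemann_of_weilClassesCMField hR h₃⟩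

/-- §1 with the WEAKEST CM-field transport hypothesis of the axis, the local germ of algebraic fibres at CM-charted
algebraic fibres (`LocalWeilVHCAtCMField`; `→` is `HC_WeilClassesCMField_of_HC_CM_local`). CONDITIONAL on all three.
[cite: Andre1992HodgeCM, p. 2] [cite: BuchweitzFlenner2003, Thm. 5.1 and Thm. 5.2]
[cite: DeligneMilne1982Tannakian, §6 Thm. 6.20 (Riemann), p. 212] -/
theorem HC_CM_iff_weilClassesCMField_of_riemann_of_transport_local (hR : DeligneMilne1982_Thm_6_20_full)
    (hP₃ : CMPointedWeilFamiliesCMField) (hL : LocalWeilVHCAtCMField) :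
    Theses.RankFourFaces.CMAbelianHodge ↔ WeilClassesCMField :=
  ⟨fun hCM ↦ HC_WeilClassesCMField_of_HC_CM_local hCM hP₃ hL,
    fun h₃ ↦ CorCM.AndreWeakForm.hc_cm_of_riemann_of_weilClassesCMField hR h₃⟩

/-! ### §2 R3 carries R∞ modulo Riemann's theorem and the quadratic transport leaves -/

/-- **R3 ⟹ R∞ through `HC_CM`**: granted Riemann's theorem, CM-pointed `ℚ(√-d)`-Weil families (`hP₂`) and the
GLOBAL Weil-confined variational Hodge statement for imaginary quadratic `K` (`hV₂`), the Weil classes of CM fields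
of degree `> 2` imply Weil's question for every imaginary quadratic field (`hc_cm_of_riemann_of_weilClassesCMField`,
then `HC_WeilClassesQuadratic_of_HC_CM`). Not a specialisation (`2 < e` in R3). CONDITIONAL on all three inputs.
[cite: Andre1992HodgeCM, p. 2] [cite: Weil1977HodgeRing, pp. 421–429]
[cite: Markman2025SecantRealMultiplication, Cor. 10.2.3 (preprint, unrefereed)] -/
theorem weilClassesImaginaryQuadratic_of_riemann_of_weilClassesCMField (hR : DeligneMilne1982_Thm_6_20_full)
    (hP₂ : CMPointedWeilFamiliesQuadratic) (hV₂ : WeilVariationalHodgeQuadratic) (h₃ : WeilClassesCMField) :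
    WeilClassesImaginaryQuadratic :=
  HC_WeilClassesQuadratic_of_HC_CM (CorCM.AndreWeakForm.hc_cm_of_riemann_of_weilClassesCMField hR h₃) hP₂ hV₂

/-- §2 with the local germ at CM-charted algebraic fibres (`LocalWeilVHCAtCMQuadratic`, via
`HC_WeilClassesQuadratic_of_HC_CM_local`). Everything below R∞ (R2 split Weil type, Weil sixfolds R1/R1′,
stmt-HodgeConjecture-2522/2524) then follows by the tree arrows of `Theorems/WeilTypeLadderOnPath.lean`.
CONDITIONAL on all three inputs. [cite: Andre1992HodgeCM, p. 2] [cite: BuchweitzFlenner2003, Thm. 5.1 and Thm. 5.2]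
[cite: Markman2025SurveySecant, §12 (preprint / ICM 2026 lecture, unrefereed)] -/
theorem weilClassesImaginaryQuadratic_of_riemann_of_weilClassesCMField_local (hR : DeligneMilne1982_Thm_6_20_full)
    (hP₂ : CMPointedWeilFamiliesQuadratic) (hL : LocalWeilVHCAtCMQuadratic) (h₃ : WeilClassesCMField) :
    WeilClassesImaginaryQuadratic :=
  HC_WeilClassesQuadratic_of_HC_CM_local (CorCM.AndreWeakForm.hc_cm_of_riemann_of_weilClassesCMField hR h₃) hP₂ hL

/-! ### §3 `HC_CM` as the CONCLUSION from three inputs (was five): Riemann + one anchor leaf + one CM-field transport leaf -/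

/-- **`HC_CM` FROM the transport line with THREE inputs.** Riemann's theorem (record) + Weil-divisorial CM-pointed
`K`-Weil families for CM fields (`hP₃`, the anchor leaf print supplies for every `K`; `HC_CM`-free by Lefschetz
(1,1)) + Weil-confined variational Hodge for CM fields (`hV₃`) ⟹ `HC_CM`: the `HC_CM`-free row R3
`HC_WeilClassesCMField_of_weilDivisorialCMPointed hP₃ hV₃`, then `hc_cm_of_riemann_of_weilClassesCMField hR`.
Compared with `HC_CM_of_andre_of_weilDivisorialCMPointed_of_variational` (five inputs) BOTH QUADRATIC LEAVES ARE
GONE and André's record is Riemann's. Divisor-generated / diagonal anchors: precompose `hP₃` with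
`weilDivisorialCMPointed_of_divisorGeneratedCMPointed` / `weilDivisorialCMPointed_of_diagonalCMPointed`.
HONEST: a kernel-checked IMPLICATION from OPEN inputs (`hP₃`, `hV₃` are Summit-side conjectural leaves; VHC on Weil
families is the whole difficulty), not a proof sketch of `HC_CM`. [cite: Andre1992HodgeCM, p. 2 and Théorème]
[cite: DeligneMilne1982Tannakian, §6 Thm. 6.20 (Riemann), p. 212] [cite: Deligne1982HodgeCycles, §4–5]
[cite: Markman2025SurveySecant, Thm. 1.4 and §12 (preprint / ICM 2026 lecture, unrefereed; strategy only)] -/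
theorem HC_CM_of_riemann_of_weilDivisorialCMPointed_of_variational (hR : DeligneMilne1982_Thm_6_20_full)
    (hP₃ : WeilDivisorialCMPointedWeilFamiliesCMField) (hV₃ : WeilVariationalHodgeCMField) :
    Theses.RankFourFaces.CMAbelianHodge :=
  CorCM.AndreWeakForm.hc_cm_of_riemann_of_weilClassesCMField hR
    (HC_WeilClassesCMField_of_weilDivisorialCMPointed hP₃ hV₃)

/-- §3 with the local germ at CM fibres (`LocalWeilVHCAtCMField`) in place of R3var
(row `HC_WeilClassesCMField_of_weilDivisorialCMPointed_local`). Same honesty clause: implication from open inputs.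
[cite: Andre1992HodgeCM, p. 2] [cite: BuchweitzFlenner2003, Thm. 5.1] [cite: CharlesSchnell2014Notes, Prop. 11.3.11 (proof)]
[cite: DeligneMilne1982Tannakian, §6 Thm. 6.20 (Riemann), p. 212] -/
theorem HC_CM_of_riemann_of_weilDivisorialCMPointed_local (hR : DeligneMilne1982_Thm_6_20_full)
    (hP₃ : WeilDivisorialCMPointedWeilFamiliesCMField) (hL : LocalWeilVHCAtCMField) :
    Theses.RankFourFaces.CMAbelianHodge :=
  CorCM.AndreWeakForm.hc_cm_of_riemann_of_weilClassesCMField hR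
    (HC_WeilClassesCMField_of_weilDivisorialCMPointed_local hP₃ hL)

/-! ### §4 The two-rung equivalence of `Ring2TransportWeilClasses` §5, re-keyed on Riemann's theorem -/

/-- **`HC_CM ↔ R∞ ∧ R3` granted Riemann's theorem and the four transport leaves** —
`HC_CM_iff_weilRungs_of_andre_of_transport` with André's record supplied by
`CorCM.AndreWeakForm.andre1992_weak_of_riemann hR`. CONDITIONAL on all five named inputs.
[cite: Andre1992HodgeCM, Théorème (pp. 4–5)] [cite: DeligneMilne1982Tannakian, §6 Thm. 6.20 (Riemann), p. 212]
[cite: Markman2025SurveySecant, Thm. 1.4 and §12 (preprint / ICM 2026 lecture, unrefereed)] -/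
theorem HC_CM_iff_weilRungs_of_riemann_of_transport (hR : DeligneMilne1982_Thm_6_20_full)
    (hP₂ : CMPointedWeilFamiliesQuadratic) (hV₂ : WeilVariationalHodgeQuadratic)
    (hP₃ : CMPointedWeilFamiliesCMField) (hV₃ : WeilVariationalHodgeCMField) :
    Theses.RankFourFaces.CMAbelianHodge ↔ WeilClassesImaginaryQuadratic ∧ WeilClassesCMField :=
  HC_CM_iff_weilRungs_of_andre_of_transport (CorCM.AndreWeakForm.andre1992_weak_of_riemann hR) hP₂ hV₂ hP₃ hV₃

/-- Consistency of §1 and §4: modulo Riemann and the quadratic leaves the R∞-conjunct of §4 is REDUNDANT (R∞ is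
implied by R3, §2). [cite: Andre1992HodgeCM, p. 2] -/
theorem weilRungs_iff_weilClassesCMField_of_riemann_of_transport (hR : DeligneMilne1982_Thm_6_20_full)
    (hP₂ : CMPointedWeilFamiliesQuadratic) (hV₂ : WeilVariationalHodgeQuadratic) :
    (WeilClassesImaginaryQuadratic ∧ WeilClassesCMField) ↔ WeilClassesCMField :=
  ⟨fun h ↦ h.2, fun h₃ ↦ ⟨weilClassesImaginaryQuadratic_of_riemann_of_weilClassesCMField hR hP₂ hV₂ h₃, h₃⟩⟩

end Summit.HodgeConjecture.HodgeConjecture.Ring2Transport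

end
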